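import Summits.QuantumFields.YangMills.Theorems.BalabanUVNodesN15KingModelAnalyticDeterminantOpNorm
import Summits.QuantumFields.YangMills.Theorems.BalabanUVNodesN15KingModelCombesThomasEffLapLipschitz
import HarnessLib

/-!
# BalabanUVNodes ∕ N15 — THE KING-MODEL RUNG (PART Ϭ-d): THE BLOCK-FIELD VACUUM-ENERGY DENSITY IS LIPSCHITZ IN THE BACKGROUND ON BAŁABAN's SCALE, η-UNIFORMLY —
# generic `|ln|det A| − ln|det B|| ≤ N·max(‖A⁻¹‖,‖B⁻¹‖)·‖A − B‖` by the MULTIPLICATIVE route (`det A = det B·det(1 + B⁻¹(A−B))`, `|det(1+E)| ≤ (1+‖E‖)^{N}`, `ln(1+x) ≤ x`; no spectral perturbation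
# theory), then (i) at EVERY PAIR of unitary backgrounds `|U−V| ≤ ε` (King's scaling `c = L²`, comb contours, NO window): `|ln det Δ_eff(U) − ln det Δ_eff(V)| ≤ N·(a⁻¹+m⁻²)·a²·Λ(Lε)` with PART Ϧ-l's
# `Λ(s) = 2(d+1)s∕m² + 2√(d+1)s∕(m²√m²) + 2(d+1)(s²+as)∕m⁴` — a function of `Lε = ε∕η` only (door t5⁵⁸ of §g52, without Lidskii), sharpened by PART Ϭ-b's global `N·ln(1+a∕m²)`; (ii) in the
# complex window `|ln|det Δ_eff(U,U⁻¹)| − ln det Δ_eff(U₀)| ≤ N·(a⁻¹+4e∕m²)·Γ₁·covLip·(Lε∕s₀)·a`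
# (Track A, DAG node N15 = NE2; FAN-OUT v1.1 §N15 s3 «KING-MODEL RUNG … + what the curved case adds»; count-neutral)

HONEST FRAMING.  Count-neutral (cell `pub-ymgap`, seat `pub-ymgap-dag-n15-e` g53; `--supports stmt-QuantumFields-27247 --as helper` = K3ᴬ, KEY MAP v3).  King's one-level comparison model at
`𝕜 = ℂ` (PART Ϫ's operator-norm toolkit lives there), `a, m² > 0`; the Lipschitz moduli carry PART Ϧ-l ∕ Ϫ-f ∕ Ϫ-g's crude constants — the CONTENT is η-uniformity on the scale `|U − V| ≤ ε₁η` and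
the absence of any window or curvature hypothesis in (i).  NOT Bałaban's multi-level `Z_k`; NOT King's loop expansion (3.94)–(3.98); NOT a node discharge (N15 of record untouched); nothing
continuum ∕ ℝ⁴ ∕ OS ∕ Clay.

THE RESULTS (`N = |T₁|·|n|`):
* §1 (generic, square complex matrices on the block lattice) `det_eq_det_mul_det_one_add` (`B` invertible ⟹ `det A = det B·det(1 + B⁻¹(A − B))`), ★ `norm_det_one_add_le` (`|det(1+E)| ≤ (1+‖E‖)^{N}`),
  ★★ `norm_det_le_norm_det_mul_pow` (`|det A| ≤ |det B|·(1 + ‖B⁻¹‖·‖A−B‖)^{N}`), ★★ `log_norm_det_sub_le` (`det A ≠ 0` ⟹ `ln|det A| − ln|det B| ≤ N·‖B⁻¹‖·‖A−B‖`),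
  ★★★ **`abs_log_norm_det_sub_le`** (`A, B` invertible ⟹ `|ln|det A| − ln|det B|| ≤ N·max(‖A⁻¹‖,‖B⁻¹‖)·‖A−B‖`).
* §2 (unitary `U, V` with `‖U_b − V_b‖ ≤ ε`, King's scaling, comb, `a, m² > 0`) ★★★★ **`abs_log_det_effLapU_sub_le_eta_uniform`** (`|ln det Δ_eff(U) − ln det Δ_eff(V)| ≤ N·(a⁻¹+m⁻²)·a²·Λ(Lε)`),
  ★★★ **`abs_log_det_effLapU_sub_le_min`** (`≤ N·min(ln(1+a∕m²), (a⁻¹+m⁻²)a²Λ(Lε))` with PART Ϭ-b), ★★★ **`abs_freeEnergyDensity_effLapU_sub_le`** (per degree of freedom: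
  `|N⁻¹ln det Δ_eff(U) − N⁻¹ln det Δ_eff(V)| ≤ (a⁻¹+m⁻²)·a²·Λ(Lε)` — THE BLOCK-FIELD VACUUM-ENERGY DENSITY IS LIPSCHITZ ON BAŁABAN's SCALE, uniformly in η, the volume, the fibre).
* §3 (complex `U` with `‖U_b − U₀_b‖ ≤ ε`, `0 < ε`, `2Lε ≤ s₀(m²,a,d)`) ★★★ **`abs_log_norm_det_cxEffLap_sub_le_eta_uniform`** (`|ln|det Δ_eff(U,U⁻¹)| − ln det Δ_eff(U₀)| ≤ N·(a⁻¹+4e∕m²)·Γ₁·covLip·(Lε∕s₀(m²,0,d))·a`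
  — the continued normalisation is Lipschitz at the unitary centre with an η-uniform modulus).
PRIOR TREE ART (by name): Ϧ-l (`l2_opNorm_effLapU_sub_le_king`, `norm_one_le_one'`), Ϫ-b (`mass_coercive_fullOpU`, `isUnit_cxEffLap_at_massRadius`), Ϫ-c (`l2_opNorm_effLapU_inv_le`,
`l2_opNorm_cxBlockCov_at_massRadius_le`), Ϫ-a (`cxBlockCov_inv_of_unitary`), Ϫ-b (`inv_cxEffLap_at_massRadius`), Ϫ-f (`windows_of_h2a`), Ϫ-g (`norm_det_le_l2_opNorm_pow`), Ϭ-a (`det_effLapU_eq_ofReal_re`,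
`re_det_effLapU_pos`), Ϭ-b (`abs_log_re_det_effLapU_sub_le`), Ϭ-c (`l2_opNorm_cxEffLap_sub_effLapU_le`), Ϥ-k (`isUnit_effLapU`), Mathlib (`Matrix.det_mul`, `Matrix.l2_opNorm_mul`, `Real.add_pow_le_pow_mul_pow_of_sq_le_sq`,
`Real.log_le_sub_one_of_pos`).  Dedup (rg at filing): basename 0 files; needles `abs_log_norm_det_sub_le|norm_det_one_add_le|abs_log_det_effLapU_sub_le_eta_uniform|abs_freeEnergyDensity_effLapU_sub_le|abs_log_norm_det_cxEffLap_sub_le_eta_uniform`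
0 tree files.  Locators: [King1986] (2.6) p.652, (2.14) p.653, (3.89)–(3.90) pp.668–669, (3.93) p.669, (4.33)–(4.34) p.674, Lemma 4.5 (4.38) p.674; [Balaban1985BackgroundPropagators] (3.37) p.396, (3.48)–(3.50)
pp.398–400, Thm 3.4 p.400.  0 `sorry`, 0 `def`.
-/

noncomputable section
open scoped BigOperators ComplexConjugate ComplexOrder Matrix.Norms.L2Operator
open Finset Matrix WithLp

namespace Summit.QuantumFields.YangMills.BalabanUVNodes.N15KingModelRung.Analytic

open Literature.MathematicalPhysics.QuantumFieldTheory.Balaban1983to89 (B4Sect5Proof.latticeConst B4Sect5Proof.latticeConst_nonneg)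
open Literature.MathematicalPhysics.QuantumFieldTheory.Balaban1983to89.B5Prop11Plancherel (Tor fine)
open Summit.QuantumFields.YangMills.BalabanUVNodes.N15KingModelRung.Covariant (fib)
open Summit.QuantumFields.YangMills.BalabanUVNodes.N15KingModelRung.CovariantBlock (BlockTree kingComb kingComb_depth_le fullOpU effLapU isUnit_effLapU)
open Summit.QuantumFields.YangMills.BalabanUVNodes.N15KingModelRung.CombesThomas (ctRate l2_opNorm_effLapU_sub_le_king norm_one_le_one')

variable {d : ℕ} {L : ℕ} [NeZero L] (M : Fin (d + 1) → ℕ) [hM : ∀ μ, NeZero (M μ)]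
variable {n : Type*} [Fintype n] [DecidableEq n]

/-! ## §1 The multiplicative route: `|ln|det A| − ln|det B|| ≤ N·max(‖A⁻¹‖,‖B⁻¹‖)·‖A − B‖` -/

section Generic

omit [NeZero L] in
/-- `B` invertible ⟹ `det A = det B·det(1 + B⁻¹(A − B))` (for `A = B·(1 + B⁻¹(A−B))`). [cite: King1986, (3.94)–(3.95) p.669 (shape)] -/
theorem det_eq_det_mul_det_one_add {A B : Matrix (Tor M × n) (Tor M × n) ℂ} (hB : IsUnit B) :
    A.det = B.det * (1 + B⁻¹ * (A - B)).det := by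
  have hBdet : IsUnit B.det := (Matrix.isUnit_iff_isUnit_det _).mp hB
  rw [← Matrix.det_mul, Matrix.mul_add, Matrix.mul_one, ← Matrix.mul_assoc, Matrix.mul_nonsing_inv _ hBdet, Matrix.one_mul, add_sub_cancel]

omit [NeZero L] in
/-- ★ `|det(1 + E)| ≤ (1 + ‖E‖)^{N}` (every eigenvalue of `1 + E` has modulus `≤ ‖1 + E‖ ≤ 1 + ‖E‖`; PART Ϫ-g's `norm_det_le_l2_opNorm_pow`). [cite: King1986, (3.96) p.669 (shape)] -/
theorem norm_det_one_add_le (E : Matrix (Tor M × n) (Tor M × n) ℂ) : ‖(1 + E).det‖ ≤ (1 + ‖E‖) ^ Fintype.card (Tor M × n) := by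
  have h1 := norm_det_le_l2_opNorm_pow M (1 + E)
  have h2 : ‖(1 : Matrix (Tor M × n) (Tor M × n) ℂ) + E‖ ≤ 1 + ‖E‖ := (norm_add_le _ _).trans (by gcongr; exact norm_one_le_one')
  exact h1.trans (pow_le_pow_left₀ (norm_nonneg _) h2 _)

omit [NeZero L] in
/-- ★★ `|det A| ≤ |det B|·(1 + ‖B⁻¹‖·‖A − B‖)^{N}` for `B` invertible. [cite: King1986, (3.94)–(3.96) p.669 (shape)] -/
theorem norm_det_le_norm_det_mul_pow {A B : Matrix (Tor M × n) (Tor M × n) ℂ} (hB : IsUnit B) :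
    ‖A.det‖ ≤ ‖B.det‖ * (1 + ‖B⁻¹‖ * ‖A - B‖) ^ Fintype.card (Tor M × n) := by
  rw [det_eq_det_mul_det_one_add M hB, norm_mul]
  refine mul_le_mul_of_nonneg_left ((norm_det_one_add_le M _).trans ?_) (norm_nonneg _)
  exact pow_le_pow_left₀ (by positivity) (by gcongr; exact Matrix.l2_opNorm_mul _ _) _

omit [NeZero L] in
/-- ★★ ONE-SIDED: `det A ≠ 0`, `B` invertible ⟹ `ln|det A| − ln|det B| ≤ N·‖B⁻¹‖·‖A − B‖` (`ln(1+x) ≤ x`). [cite: King1986, (3.96) p.669 (shape, n = 1)] -/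
theorem log_norm_det_sub_le {A B : Matrix (Tor M × n) (Tor M × n) ℂ} (hA : A.det ≠ 0) (hB : IsUnit B) :
    Real.log ‖A.det‖ - Real.log ‖B.det‖ ≤ Fintype.card (Tor M × n) * (‖B⁻¹‖ * ‖A - B‖) := by
  have hBdet : B.det ≠ 0 := ((Matrix.isUnit_iff_isUnit_det _).mp hB).ne_zero
  have hA' : 0 < ‖A.det‖ := norm_pos_iff.mpr hA
  have hB' : 0 < ‖B.det‖ := norm_pos_iff.mpr hBdet
  have h := norm_det_le_norm_det_mul_pow M hB (A := A)
  have hx : 0 ≤ ‖B⁻¹‖ * ‖A - B‖ := by positivity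
  have hlog := Real.log_le_log hA' h
  rw [Real.log_mul hB'.ne' (pow_pos (by positivity) _).ne', Real.log_pow] at hlog
  have hl1 : Real.log (1 + ‖B⁻¹‖ * ‖A - B‖) ≤ ‖B⁻¹‖ * ‖A - B‖ := by
    have := Real.log_le_sub_one_of_pos (by positivity : 0 < 1 + ‖B⁻¹‖ * ‖A - B‖)
    linarith
  have hN : (0 : ℝ) ≤ Fintype.card (Tor M × n) := Nat.cast_nonneg _
  nlinarith [mul_le_mul_of_nonneg_left hl1 hN]

omit [NeZero L] in
/-- ★★★ **THE LOGARITHM OF THE DETERMINANT IS LIPSCHITZ IN OPERATOR NORM ON THE INVERTIBLES**: `A, B` invertible ⟹ `|ln|det A| − ln|det B|| ≤ N·max(‖A⁻¹‖,‖B⁻¹‖)·‖A − B‖` — the multiplicative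
route, no spectral perturbation theory. [cite: King1986, (3.94)–(3.96) p.669 (shape)] -/
theorem abs_log_norm_det_sub_le {A B : Matrix (Tor M × n) (Tor M × n) ℂ} (hA : IsUnit A) (hB : IsUnit B) :
    |Real.log ‖A.det‖ - Real.log ‖B.det‖| ≤ Fintype.card (Tor M × n) * (max ‖A⁻¹‖ ‖B⁻¹‖ * ‖A - B‖) := by
  have hAdet : A.det ≠ 0 := ((Matrix.isUnit_iff_isUnit_det _).mp hA).ne_zero
  have hBdet : B.det ≠ 0 := ((Matrix.isUnit_iff_isUnit_det _).mp hB).ne_zero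
  have h1 := log_norm_det_sub_le M hAdet hB
  have h2 := log_norm_det_sub_le M hBdet hA
  rw [norm_sub_rev B A] at h2
  have hN : (0 : ℝ) ≤ Fintype.card (Tor M × n) := Nat.cast_nonneg _
  have hAB : 0 ≤ ‖A - B‖ := norm_nonneg _
  have hm1 : ‖B⁻¹‖ * ‖A - B‖ ≤ max ‖A⁻¹‖ ‖B⁻¹‖ * ‖A - B‖ := mul_le_mul_of_nonneg_right (le_max_right _ _) hAB
  have hm2 : ‖A⁻¹‖ * ‖A - B‖ ≤ max ‖A⁻¹‖ ‖B⁻¹‖ * ‖A - B‖ := mul_le_mul_of_nonneg_right (le_max_left _ _) hAB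
  rw [abs_sub_le_iff]
  constructor
  · exact h1.trans (mul_le_mul_of_nonneg_left hm1 hN)
  · exact h2.trans (mul_le_mul_of_nonneg_left hm2 hN)

end Generic

/-! ## §2 Every pair of unitary backgrounds on Bałaban's scale (no window) -/

section UnitaryPairs

variable {a m2 : ℝ} (ha : 0 < a) (hm : 0 < m2)
variable {U V : Tor (fine L M) × Fin (d + 1) → Matrix n n ℂ} (hU : ∀ bd, U bd ∈ Matrix.unitaryGroup n ℂ) (hV : ∀ bd, V bd ∈ Matrix.unitaryGroup n ℂ)
variable {ε : ℝ} (hε0 : 0 ≤ ε) (hε : ∀ bd, ‖U bd - V bd‖ ≤ ε)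
include ha hm hU hV hε0 hε

/-- ★★★★ **THE BLOCK-FIELD NORMALISATION IS LIPSCHITZ IN THE BACKGROUND ON BAŁABAN's SCALE, AT EVERY PAIR OF UNITARY BACKGROUNDS** (King's scaling `c = L²`, comb contours, `a, m² > 0`, any
curvature, no window): `|ln det Δ_eff(U) − ln det Δ_eff(V)| ≤ N·(a⁻¹+m⁻²)·a²·(2(d+1)(Lε)∕m² + 2√(d+1)(Lε)∕(m²√m²) + 2(d+1)((Lε)²+a(Lε))∕m⁴)` — a function of `Lε = ε∕η` only: PART Ϧ-l's operator-norm
Lipschitz bound at the mass floor and PART Ϫ-c's `‖(Δ_eff)⁻¹‖ ≤ a⁻¹+m⁻²` through §1. [cite: King1986, (2.14) p.653, (3.89)–(3.90) pp.668–669, (4.33)–(4.34) p.674; Balaban1985BackgroundPropagators, (3.37) p.396, (3.48)–(3.50) pp.398–400 (shape)] -/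
theorem abs_log_det_effLapU_sub_le_eta_uniform :
    |Real.log (RCLike.re (effLapU (kingComb d L) M a ((L : ℝ) ^ 2) m2 U).det) - Real.log (RCLike.re (effLapU (kingComb d L) M a ((L : ℝ) ^ 2) m2 V).det)|
      ≤ Fintype.card (Tor M × n) * ((a⁻¹ + m2⁻¹) * (a ^ 2 * (2 * ((d : ℝ) + 1) * ((L : ℝ) * ε) * m2⁻¹
          + (2 * Real.sqrt ((d : ℝ) + 1) * ((L : ℝ) * ε) / (m2 * Real.sqrt m2) + 2 * ((d : ℝ) + 1) * (((L : ℝ) * ε) ^ 2 + a * ((L : ℝ) * ε)) / m2 ^ 2)))) := by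
  have hc : (0 : ℝ) ≤ (L : ℝ) ^ 2 := by positivity
  have hAU : IsUnit (effLapU (kingComb d L) M a ((L : ℝ) ^ 2) m2 U) := isUnit_effLapU (kingComb d L) M ha hc hm hU
  have hAV : IsUnit (effLapU (kingComb d L) M a ((L : ℝ) ^ 2) m2 V) := isUnit_effLapU (kingComb d L) M ha hc hm hV
  have h := abs_log_norm_det_sub_le M hAU hAV
  -- the determinants are positive reals
  have eU : ‖(effLapU (kingComb d L) M a ((L : ℝ) ^ 2) m2 U).det‖ = RCLike.re (effLapU (kingComb d L) M a ((L : ℝ) ^ 2) m2 U).det := by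
    rw [det_effLapU_eq_ofReal_re (kingComb d L) M ha hc hm hU, RCLike.norm_ofReal, RCLike.ofReal_re, abs_of_pos (re_det_effLapU_pos (kingComb d L) M ha hc hm hU)]
  have eV : ‖(effLapU (kingComb d L) M a ((L : ℝ) ^ 2) m2 V).det‖ = RCLike.re (effLapU (kingComb d L) M a ((L : ℝ) ^ 2) m2 V).det := by
    rw [det_effLapU_eq_ofReal_re (kingComb d L) M ha hc hm hV, RCLike.norm_ofReal, RCLike.ofReal_re, abs_of_pos (re_det_effLapU_pos (kingComb d L) M ha hc hm hV)]
  rw [eU, eV] at h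
  have hinvU : ‖(effLapU (kingComb d L) M a ((L : ℝ) ^ 2) m2 U)⁻¹‖ ≤ a⁻¹ + m2⁻¹ := l2_opNorm_effLapU_inv_le (kingComb d L) M kingComb_depth_le ha hc hm hU
  have hinvV : ‖(effLapU (kingComb d L) M a ((L : ℝ) ^ 2) m2 V)⁻¹‖ ≤ a⁻¹ + m2⁻¹ := l2_opNorm_effLapU_inv_le (kingComb d L) M kingComb_depth_le ha hc hm hV
  have hmax : max ‖(effLapU (kingComb d L) M a ((L : ℝ) ^ 2) m2 U)⁻¹‖ ‖(effLapU (kingComb d L) M a ((L : ℝ) ^ 2) m2 V)⁻¹‖ ≤ a⁻¹ + m2⁻¹ := max_le hinvU hinvV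
  have hLip := l2_opNorm_effLapU_sub_le_king M ha.le hm.le hU hV hε0 hε hm
    (mass_coercive_fullOpU (kingComb d L) M ha.le hc m2 hU) (mass_coercive_fullOpU (kingComb d L) M ha.le hc m2 hV)
  have hN : (0 : ℝ) ≤ Fintype.card (Tor M × n) := Nat.cast_nonneg _
  refine h.trans (mul_le_mul_of_nonneg_left ?_ hN)
  exact mul_le_mul hmax hLip (norm_nonneg _) (by positivity)

/-- ★★★ **… AND NEVER MORE THAN PART Ϭ-b's GLOBAL `N·ln(1+a∕m²)`**: `|ln det Δ_eff(U) − ln det Δ_eff(V)| ≤ N·min(ln(1+a∕m²), (a⁻¹+m⁻²)a²Λ(Lε))`.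
[cite: King1986, (2.14) p.653, (3.89)–(3.90) pp.668–669, (4.33) p.674] -/
theorem abs_log_det_effLapU_sub_le_min :
    |Real.log (RCLike.re (effLapU (kingComb d L) M a ((L : ℝ) ^ 2) m2 U).det) - Real.log (RCLike.re (effLapU (kingComb d L) M a ((L : ℝ) ^ 2) m2 V).det)|
      ≤ Fintype.card (Tor M × n) * min (Real.log (1 + a / m2)) ((a⁻¹ + m2⁻¹) * (a ^ 2 * (2 * ((d : ℝ) + 1) * ((L : ℝ) * ε) * m2⁻¹
          + (2 * Real.sqrt ((d : ℝ) + 1) * ((L : ℝ) * ε) / (m2 * Real.sqrt m2) + 2 * ((d : ℝ) + 1) * (((L : ℝ) * ε) ^ 2 + a * ((L : ℝ) * ε)) / m2 ^ 2)))) := by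
  have h1 := abs_log_re_det_effLapU_sub_le (kingComb d L) M ha (by positivity : (0 : ℝ) ≤ (L : ℝ) ^ 2) hm hU hV
  have h2 := abs_log_det_effLapU_sub_le_eta_uniform M ha hm hU hV hε0 hε
  rw [mul_min_of_nonneg _ _ (Nat.cast_nonneg _)]
  exact le_min h1 h2

/-- ★★★ **THE BLOCK-FIELD VACUUM-ENERGY DENSITY IS LIPSCHITZ ON BAŁABAN's SCALE** (nonempty fibre): per degree of freedom,
`|N⁻¹ln det Δ_eff(U) − N⁻¹ln det Δ_eff(V)| ≤ (a⁻¹+m⁻²)·a²·Λ(Lε)` — uniformly in the spacing, the volume and the fibre. [cite: King1986, (2.6) p.652, (3.89)–(3.90) pp.668–669, (3.93) p.669, (4.34) p.674] -/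
theorem abs_freeEnergyDensity_effLapU_sub_le [Nonempty n] :
    |Real.log (RCLike.re (effLapU (kingComb d L) M a ((L : ℝ) ^ 2) m2 U).det) / Fintype.card (Tor M × n)
        - Real.log (RCLike.re (effLapU (kingComb d L) M a ((L : ℝ) ^ 2) m2 V).det) / Fintype.card (Tor M × n)|
      ≤ (a⁻¹ + m2⁻¹) * (a ^ 2 * (2 * ((d : ℝ) + 1) * ((L : ℝ) * ε) * m2⁻¹
          + (2 * Real.sqrt ((d : ℝ) + 1) * ((L : ℝ) * ε) / (m2 * Real.sqrt m2) + 2 * ((d : ℝ) + 1) * (((L : ℝ) * ε) ^ 2 + a * ((L : ℝ) * ε)) / m2 ^ 2))) := by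
  have hN : (0 : ℝ) < Fintype.card (Tor M × n) := by exact_mod_cast Fintype.card_pos
  have h := abs_log_det_effLapU_sub_le_eta_uniform M ha hm hU hV hε0 hε
  rw [← sub_div, abs_div, abs_of_pos hN, div_le_iff₀ hN, mul_comm]
  exact h

end UnitaryPairs

/-! ## §3 The complex window around a unitary background -/

section Window

variable (T : BlockTree d L) (hD : ∀ j, T.depth j ≤ (d + 1) * (L - 1)) {a m2 : ℝ} (ha : 0 < a) (hm : 0 < m2) (hL : 1 ≤ L)
variable {U₀ U : Tor (fine L M) × Fin (d + 1) → Matrix n n ℂ} (hU₀ : ∀ bd, U₀ bd ∈ Matrix.unitaryGroup n ℂ)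
variable {ε : ℝ} (hε : 0 < ε) (hU : ∀ bd, ‖U bd - U₀ bd‖ ≤ ε) (h2a : 2 * ((L : ℝ) * ε) ≤ sliceRadius m2 a d)
include hD ha hm hL hU₀ hε hU h2a

/-- ★★★ **THE CONTINUED NORMALISATION IS LIPSCHITZ AT THE UNITARY CENTRE WITH AN η-UNIFORM MODULUS**: complex `U` with `‖U_b − U₀_b‖ ≤ ε`, `0 < ε`, `2Lε ≤ s₀(m²,a,d)`:
`|ln|det Δ_eff(U,U⁻¹)| − ln det Δ_eff(U₀)| ≤ N·(a⁻¹ + 4e∕m²)·(Γ₁·covLip·(Lε∕s₀(m²,0,d))·a)` (§1 with PART Ϫ-c's `‖C‖ ≤ a⁻¹+4e∕m²` and PART Ϭ-c's operator-norm Lipschitz bound).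
[cite: King1986, (2.14) p.653, (3.89)–(3.90) pp.668–669, Lemma 4.5 (4.38) p.674, (4.44) p.675; Balaban1985BackgroundPropagators, Thm 3.4 p.400] -/
theorem abs_log_norm_det_cxEffLap_sub_le_eta_uniform :
    |Real.log ‖(cxEffLap T M a ((L : ℝ) ^ 2) m2 U (fun bd => (U bd)⁻¹)).det‖ - Real.log (RCLike.re (effLapU T M a ((L : ℝ) ^ 2) m2 U₀).det)|
      ≤ Fintype.card (Tor M × n) * ((a⁻¹ + 4 / m2 * Real.exp 1)
          * ((a + a ^ 2 * (8 / m2 * Real.exp 3)) * B4Sect5Proof.latticeConst (d + 1) (ctRate (m2 / 2) a d) * (covLip m2 d * ((L : ℝ) * ε / sliceRadius m2 0 d)) * a)) := by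
  obtain ⟨h2, hrad⟩ := windows_of_h2a (L := L) ha hm hε h2a
  have hc : (0 : ℝ) ≤ (L : ℝ) ^ 2 := by positivity
  set ΔU := cxEffLap T M a ((L : ℝ) ^ 2) m2 U (fun bd => (U bd)⁻¹) with hΔU
  set Δ0 := effLapU T M a ((L : ℝ) ^ 2) m2 U₀ with hΔ0
  have hAU : IsUnit ΔU := isUnit_cxEffLap_at_massRadius T M hD ha hm hL hU₀ hε.le hU hrad
  have hA0 : IsUnit Δ0 := isUnit_effLapU T M ha hc hm hU₀
  have h := abs_log_norm_det_sub_le M hAU hA0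
  have e0 : ‖Δ0.det‖ = RCLike.re Δ0.det := by
    rw [hΔ0, det_effLapU_eq_ofReal_re T M ha hc hm hU₀, RCLike.norm_ofReal, RCLike.ofReal_re, abs_of_pos (re_det_effLapU_pos T M ha hc hm hU₀)]
  rw [e0] at h
  have hinvU : ‖ΔU⁻¹‖ ≤ a⁻¹ + 4 / m2 * Real.exp 1 := by
    rw [hΔU, inv_cxEffLap_at_massRadius T M hD ha hm hL hU₀ hε.le hU hrad]
    exact l2_opNorm_cxBlockCov_at_massRadius_le T M hD ha hm hL hU₀ hε.le hU hrad
  have hinv0 : ‖Δ0⁻¹‖ ≤ a⁻¹ + 4 / m2 * Real.exp 1 := by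
    have h1 : ‖Δ0⁻¹‖ ≤ a⁻¹ + m2⁻¹ := l2_opNorm_effLapU_inv_le T M hD ha hc hm hU₀
    have h2' : m2⁻¹ ≤ 4 / m2 * Real.exp 1 := by
      rw [inv_eq_one_div, div_mul_eq_mul_div, div_le_div_iff_of_pos_right hm]
      nlinarith [Real.add_one_le_exp (1 : ℝ)]
    linarith
  have hmax : max ‖ΔU⁻¹‖ ‖Δ0⁻¹‖ ≤ a⁻¹ + 4 / m2 * Real.exp 1 := max_le hinvU hinv0
  have hLip := l2_opNorm_cxEffLap_sub_effLapU_le T M hD ha hm hL hU₀ hε hU h2a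
  have hN : (0 : ℝ) ≤ Fintype.card (Tor M × n) := Nat.cast_nonneg _
  refine h.trans (mul_le_mul_of_nonneg_left ?_ hN)
  exact mul_le_mul hmax hLip (norm_nonneg _) (by positivity)

end Window

end Summit.QuantumFields.YangMills.BalabanUVNodes.N15KingModelRung.Analytic

end
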